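import Literature.MathematicalPhysics.QuantumFieldTheory.Balaban1983to89.GaussianSmallField
import Literature.MathematicalPhysics.QuantumFieldTheory.Balaban1983to89.B1Eq324BenfattoAppendixA
import HarnessLib

/-!
# `Balaban1983to89.B1Eq324BenfattoKernelAppendixCLemma2` — [BenfattoEtAl1978] Appendix C p. 165, LEMMA 2 (the small-field volume of a conditioned
# Gaussian field) FOR A GENERAL SHIFTED GAUSSIAN FIELD — any index set, any positive semidefinite kernel, any centre: PROVED

statement-level skeleton of published theorems with citation tags; proofs where landed; nothing here is a claim about the
Yang–Mills mass gap

WHY THIS MODULE (cell `pub-ymgap`, seat `dag-n08-c` gen 21, INTENT-2; node N08 [Balaban1985UV3]; the [BenfattoEtAl1978] source chain behind the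
(α)-row `h324c`).  Lemma 2 of Appendix C is one of the 28 library theorems through which the §5 road of the Basic Lemma reads the free field
(kernel census `HOME/pub-ymgap-dag-n08-c/N08-BASICLEMMA-KERNEL-CENSUS.md` §2 (C); consumers `…Sect5ChiToOneOnData.measureReal_ne_one_le_of_eq_one_on`,
`…Sect5Cumulant.eq519_condField`).  The tree proves it (`…AppendixCLemma2.appC_lemma2`, seat n08-b) for the CONDITIONED FREE FIELD `condField d α β Γ z̄`;
but print's one-line proof — *"Since the covariance with Dirichelet boundary conditions is bounded by (C.6) and since the center of the gaussian
distribution P(dz|z̄_Γ) is bounded, using (C.8), by … we get immediately the lemma 2"* — uses only TWO facts about the conditioned measure: a ONE-SITE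
VARIANCE bound and a CENTRE bound with a margin below the threshold.  This file proves Lemma 2 in exactly that generality: for the shifted Gaussian
field `μ_{m,K} := (gaussianFieldOfKernel K).map (ζ ↦ m + ζ)` of ANY positive semidefinite kernel `K` on ANY index set `S` with ANY centre `m`
(the shape of `condField` = `μ_{condMean, condCov}` and of `…AppendixDWick` §2), so that for a CLASS of Gaussian fields ([Balaban1982Higgs1] p. 616
«all the assumptions are satisfied») Lemma 2 is a CONSEQUENCE of the (C.6)∕(C.8)-type hypotheses and not a hypothesis of its own.

WHAT IS PROVED (standard axioms; no `sorry`; no definition).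
* §1 `isProbabilityMeasure_gaussianFieldOfKernel_map_add`; ★ `real_abs_eval_ge_le_of_shift` — one site: `K x x ≤ C`, `|m x| ≤ t` ⇒
  `μ_{m,K}{t ≤ |z_x|} ≤ 2e^{−(t − |m x|)²∕(2C)}` (recentre + the Gaussian tail `GaussianSmallField.gaussianReal_real_abs_sub_mean_ge_le`).
* §2 ★★ `real_forall_abs_lt_ge_of_shift` — thresholds `θ : S → ℝ`, margin `r ≥ 0`: if `K x x ≤ C` and `|m x| + r ≤ θ x` for `x ∈ □` then
  `μ_{m,K}{∀ x ∈ □, |z_x| < θ x} ≥ 1 − 2|□|e^{−r²∕(2C)}` (union bound).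
* §3 ★ `appC_lemma2_of_shift` — print's shape on `Q₀ = ℤ^d`: `K x x ≤ ½` and `|m x| ≤ ½·b(1 + d(I, x))` on `□` ⇒
  `μ_{m,K}{∀ x ∈ □, |z_x| < b(1 + d(I, x))} ≥ 1 − 2|□|e^{−b²∕4}`.  The tree's `appC_lemma2` is the instance `K := condCov (freeCov d α β) Γ`,
  `m := condMean (freeCov d α β) Γ z̄` with the centre bound supplied by `…CondCentre.abs_condMean_freeCov_le'` and the variance bound by
  `…AppendixC.condCov_self_le` + `E z² ≤ ½` (not re-derived here).
HONEST SCOPE.  A Gaussian tail and a union bound; the (C.6)∕(C.8)-type inputs are HYPOTHESES here (their suppliers for a class are the sibling modules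
`…ClassAppendixC` (n08-b) ∕ `…KernelRegression` (n08-d)); count-neutral for N08; `BasicLemmaPrinted` is already a theorem and is not used; nothing
about d = 4, the continuum, OS axioms, a mass gap or the Clay problem.
-/

noncomputable section

open MeasureTheory ProbabilityTheory Finset
open scoped BigOperators NNReal ENNReal

namespace Literature.MathematicalPhysics.QuantumFieldTheory.Balaban1983to89.B1Eq324BenfattoKernelAppendixCLemma2

open Literature.MathematicalPhysics.QuantumFieldTheory
open Literature.MathematicalPhysics.QuantumFieldTheory.Balaban1983to89.B1Eq324BenfattoLemma
open Literature.MathematicalPhysics.QuantumFieldTheory.Balaban1983to89.B1Eq324BenfattoAppendixA (distToRegion_nonneg)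

/-! ## §1  One site of a shifted Gaussian field -/

section OneSite

variable {S : Type*} [DecidableEq S] {K : S → S → ℝ}

/-- The shifted kernel field `μ_{m,K} = (μ_K)∘(m + ·)⁻¹` is a probability measure. [cite: BenfattoEtAl1978, Appendix C (C.1), (C.7)–(C.8) p.164] -/
theorem isProbabilityMeasure_gaussianFieldOfKernel_map_add (hK : IsPosSemidefKernel K) (m : S → ℝ) :
    IsProbabilityMeasure ((gaussianFieldOfKernel K).map fun (ζ : S → ℝ) (y : S) => m y + ζ y) := by
  haveI := isProbabilityMeasure_gaussianFieldOfKernel hK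
  exact Measure.isProbabilityMeasure_map
    (measurable_pi_lambda _ fun y => measurable_const.add (measurable_pi_apply y)).aemeasurable

/-- **ONE-SITE LARGE-FIELD PROBABILITY OF A SHIFTED GAUSSIAN FIELD**: for a positive semidefinite kernel `K` on any index set, a centre `m`,
a site `x` with variance `K x x ≤ C` (`C > 0`) and a level `t ≥ |m x|`: `μ_{m,K}{t ≤ |z_x|} ≤ 2·exp(−(t − |m x|)²∕(2C))` (recentre:
`|z_x| ≥ t ⇒ |z_x − m_x| ≥ t − |m_x|`; the centred coordinate is `N(0, K x x)`).  For `K := condCov (freeCov d α β) Γ`, `m := condMean … z̄` this is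
`…AppendixCLemma2.condField_real_abs_ge_le`. [cite: BenfattoEtAl1978, Appendix C Lemma 2 p.165] -/
theorem real_abs_eval_ge_le_of_shift (hK : IsPosSemidefKernel K) (m : S → ℝ) (x : S) {C t : ℝ} (hC : 0 < C)
    (hvar : K x x ≤ C) (ht : |m x| ≤ t) :
    ((gaussianFieldOfKernel K).map fun (ζ : S → ℝ) (y : S) => m y + ζ y).real {z | t ≤ |z x|} ≤
      2 * Real.exp (-((t - |m x|) ^ 2 / (2 * C))) := by
  set Q := gaussianFieldOfKernel K with hQ
  haveI := isProbabilityMeasure_gaussianFieldOfKernel hK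
  -- the shift map
  set T : (S → ℝ) → (S → ℝ) := fun ζ y => m y + ζ y with hT
  have hTm : Measurable T := measurable_pi_lambda _ fun y => measurable_const.add (measurable_pi_apply y)
  have hmeas : MeasurableSet {z : S → ℝ | t ≤ |z x|} :=
    measurableSet_le measurable_const (continuous_abs.measurable.comp (measurable_pi_apply x))
  rw [map_measureReal_apply hTm hmeas]
  -- `T⁻¹{t ≤ |z_x|} ⊆ {t − |m_x| ≤ |ζ_x − 0|}`
  have hsub : T ⁻¹' {z : S → ℝ | t ≤ |z x|} ⊆ (fun ζ : S → ℝ => ζ x) ⁻¹' {r : ℝ | t - |m x| ≤ |r - 0|} := by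
    intro ζ hζ
    simp only [Set.mem_preimage, Set.mem_setOf_eq, hT, sub_zero] at hζ ⊢
    have := abs_add_le (m x) (ζ x)
    linarith
  -- the centred coordinate is Gaussian with variance `K x x ≤ C`
  have hX : HasGaussianLaw (fun ζ : S → ℝ => ζ x) Q := (isGaussianProcess_eval_gaussianFieldOfKernel hK).hasGaussianLaw_eval x
  have hmap := hX.map_eq_gaussianReal
  have hmean : ∫ ζ, ζ x ∂Q = 0 := integral_eval_gaussianFieldOfKernel hK x
  have hv : Var[fun ζ : S → ℝ => ζ x; Q] = K x x := by
    rw [← covariance_self (measurable_pi_apply x).aemeasurable, covariance_eval_gaussianFieldOfKernel hK x x]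
  rw [hmean, hv] at hmap
  have hvC : (((K x x).toNNReal : ℝ≥0) : ℝ) ≤ C := by
    rw [Real.coe_toNNReal']
    exact max_le hvar hC.le
  have hmeas' : MeasurableSet {r : ℝ | t - |m x| ≤ |r - 0|} := measurableSet_le measurable_const (by fun_prop)
  calc Q.real (T ⁻¹' {z | t ≤ |z x|})
      ≤ Q.real ((fun ζ : S → ℝ => ζ x) ⁻¹' {r : ℝ | t - |m x| ≤ |r - 0|}) :=
        measureReal_mono hsub (measure_ne_top _ _)
    _ = (Q.map fun ζ : S → ℝ => ζ x).real {r : ℝ | t - |m x| ≤ |r - 0|} :=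
        (map_measureReal_apply (measurable_pi_apply x) hmeas').symm
    _ ≤ 2 * Real.exp (-((t - |m x|) ^ 2 / (2 * C))) := by
        rw [hmap]
        exact GaussianSmallField.gaussianReal_real_abs_sub_mean_ge_le (m := 0) hC hvC (sub_nonneg.2 ht)

end OneSite

/-! ## §2  Lemma 2 for a shifted Gaussian field: the union bound over a box of sites -/

section Box

variable {S : Type*} [DecidableEq S] {K : S → S → ℝ}

/-- **LEMMA 2 OF APPENDIX C, GENERAL FORM**: for a positive semidefinite kernel `K` on any index set, a centre `m`, a finite box `□`, thresholds
`θ`, a variance bound `K x x ≤ C` (`C > 0`) and a MARGIN `r ≥ 0` with `|m x| + r ≤ θ x` for every `x ∈ □`: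
`μ_{m,K}{z | ∀ x ∈ □, |z_x| < θ x} ≥ 1 − 2|□|·exp(−r²∕(2C))` — the complement is covered by the one-site large-field events, each of probability
`≤ 2e^{−r²∕(2C)}` (§1). [cite: BenfattoEtAl1978, Appendix C Lemma 2 p.165] -/
theorem real_forall_abs_lt_ge_of_shift (hK : IsPosSemidefKernel K) (m : S → ℝ) (box : Finset S) (θ : S → ℝ) {C r : ℝ}
    (hC : 0 < C) (hr : 0 ≤ r) (hvar : ∀ x ∈ box, K x x ≤ C) (hm : ∀ x ∈ box, |m x| + r ≤ θ x) :
    1 - 2 * (box.card : ℝ) * Real.exp (-(r ^ 2 / (2 * C))) ≤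
      ((gaussianFieldOfKernel K).map fun (ζ : S → ℝ) (y : S) => m y + ζ y).real {z | ∀ x ∈ box, |z x| < θ x} := by
  set P := (gaussianFieldOfKernel K).map fun (ζ : S → ℝ) (y : S) => m y + ζ y with hP
  haveI : IsProbabilityMeasure P := isProbabilityMeasure_gaussianFieldOfKernel_map_add hK m
  -- the complement is covered by the one-site large-field events
  set E : Set (S → ℝ) := {z | ∀ x ∈ box, |z x| < θ x} with hE
  have hEmeas : MeasurableSet E := by
    have : E = ⋂ x ∈ box, {z : S → ℝ | |z x| < θ x} := by
      ext z
      simp only [hE, Set.mem_setOf_eq, Set.mem_iInter]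
    rw [this]
    exact MeasurableSet.biInter (Finset.countable_toSet box) fun x _ =>
      measurableSet_lt (continuous_abs.measurable.comp (measurable_pi_apply x)) measurable_const
  have hcompl : Eᶜ ⊆ ⋃ x ∈ box, {z : S → ℝ | θ x ≤ |z x|} := by
    intro z hz
    simp only [hE, Set.mem_compl_iff, Set.mem_setOf_eq, not_forall, not_lt] at hz
    obtain ⟨x, hx, hle⟩ := hz
    exact Set.mem_biUnion hx hle
  -- one site: margin `≥ r`
  have hsite : ∀ x ∈ box, P.real {z | θ x ≤ |z x|} ≤ 2 * Real.exp (-(r ^ 2 / (2 * C))) := by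
    intro x hx
    have hθ : |m x| ≤ θ x := by linarith [hm x hx]
    have h := real_abs_eval_ge_le_of_shift hK m x hC (hvar x hx) hθ
    refine h.trans (mul_le_mul_of_nonneg_left (Real.exp_le_exp.2 ?_) (by norm_num))
    have hmargin : r ≤ θ x - |m x| := by linarith [hm x hx]
    have hsq : r ^ 2 ≤ (θ x - |m x|) ^ 2 := pow_le_pow_left₀ hr hmargin 2
    exact neg_le_neg (div_le_div_of_nonneg_right hsq (by positivity))
  -- assemble
  have h1 : P.real Eᶜ ≤ 2 * (box.card : ℝ) * Real.exp (-(r ^ 2 / (2 * C))) := by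
    calc P.real Eᶜ ≤ P.real (⋃ x ∈ box, {z : S → ℝ | θ x ≤ |z x|}) := measureReal_mono hcompl (measure_ne_top _ _)
      _ ≤ ∑ x ∈ box, P.real {z : S → ℝ | θ x ≤ |z x|} := measureReal_biUnion_finset_le _ _
      _ ≤ ∑ _x ∈ box, 2 * Real.exp (-(r ^ 2 / (2 * C))) := Finset.sum_le_sum hsite
      _ = 2 * (box.card : ℝ) * Real.exp (-(r ^ 2 / (2 * C))) := by
          rw [Finset.sum_const, nsmul_eq_mul]
          ring
  have h2 : P.real E + P.real Eᶜ = 1 := probReal_add_probReal_compl hEmeas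
  linarith

end Box

/-! ## §3  Print's shape on `Q₀ = ℤ^d`: thresholds `b(1 + d(I, Δ))`, variance `½`, centre within half the threshold -/

section Lattice

variable {d : ℕ} {K : B1Eq324BenfattoLemma.Site d → B1Eq324BenfattoLemma.Site d → ℝ}

/-- **LEMMA 2 OF APPENDIX C FOR A GENERAL CONDITIONED FIELD ON THE LATTICE**: for a positive semidefinite kernel `K` on `Q₀` with one-site
variances `K x x ≤ ½` on `□` (print: «E z_Δ² = ½» and (C.6) `C^Γ_ΔΔ ≤ C_ΔΔ`) and a centre with `|m x| ≤ ½·b(1 + d(I, x))` on `□` (print: (C.8) under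
`|z̄_Δ| ≦ γb(1 + d(I, Δ))` with `γ` small), `b > 0`:
`μ_{m,K}{z | ∀ x ∈ □, |z_x| < b(1 + d(I, x))} ≥ 1 − 2|□|e^{−b²∕4}`.  The tree's `…AppendixCLemma2.appC_lemma2` is the free-field instance
(`K := condCov (freeCov d α β) Γ`, `m := condMean (freeCov d α β) Γ z̄`, centre bound from `…CondCentre.abs_condMean_freeCov_le'`).
[cite: BenfattoEtAl1978, Appendix C Lemma 2 p.165] -/
theorem appC_lemma2_of_shift (hK : IsPosSemidefKernel K) (m : B1Eq324BenfattoLemma.Site d → ℝ) {b : ℝ} (hb : 0 < b)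
    (I box : Finset (B1Eq324BenfattoLemma.Site d)) (hvar : ∀ x ∈ box, K x x ≤ 1 / 2)
    (hm : ∀ x ∈ box, |m x| ≤ 1 / 2 * b * (1 + distToRegion I x)) :
    1 - 2 * (box.card : ℝ) * Real.exp (-(b ^ 2 / 4)) ≤
      ((gaussianFieldOfKernel K).map fun (ζ : B1Eq324BenfattoLemma.Site d → ℝ) (y : B1Eq324BenfattoLemma.Site d) => m y + ζ y).real
        {z | ∀ x ∈ box, |z x| < b * (1 + distToRegion I x)} := by
  have h := real_forall_abs_lt_ge_of_shift hK m box (fun x => b * (1 + distToRegion I x)) (C := 1 / 2) (r := b / 2)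
    (by norm_num) (by linarith) hvar (fun x hx => ?_)
  · have hexp : Real.exp (-((b / 2) ^ 2 / (2 * (1 / 2)))) = Real.exp (-(b ^ 2 / 4)) := by
      congr 1
      ring
    rw [hexp] at h
    exact h
  · have hd0 : 0 ≤ distToRegion I x := distToRegion_nonneg I x
    have h1 := hm x hx
    nlinarith

end Lattice

end Literature.MathematicalPhysics.QuantumFieldTheory.Balaban1983to89.B1Eq324BenfattoKernelAppendixCLemma2

end
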